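import Literature.Topology.FourManifolds.KhCurlArcs
import Literature.Topology.FourManifolds.KhComplexFaceLocalProofs
import HarnessLib

/-!
# The curl of the first Reidemeister move: the faces through the curl chord anticommute

Sibling file of `KhComplex.lean`, continuing `KhCurlArcs` in the invariance programme for
`Literature.Topology.FourManifolds.GaussDiagram.nonempty_iso_khovanovHomology_of_equiv`
(Khovanov (2000), Thm. 1; first Reidemeister move, §5.1–5.2). The complex of the curled diagram
`G.curl tf ε` is, as a group, `C(D') = C₀ ⊕ C₁` according to the smoothing of the curl chord, with
differential `d' = (d₀, Φ, d₁)` where `Φ : C₀ → C₁` is the curl edge (`KhCurlIncidence`). The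
identity `Φ d₀ + d₁ Φ = 0` — i.e. that `Φ` is a chain map up to the Koszul sign, equivalently
that multiplication/comultiplication at the base point commutes with the old differential — is
the vanishing of the entries of `d'²` from `C₀` to `C₁`, and it holds for *every* Gauss diagram:

* `sum_incidence_mul_incidence_curl_eq_zero` — for enhanced states `s'` with the curl
  `0`-smoothed and `u'` with the curl `1`-smoothed, `∑_y ⟨d s', y⟩ ⟨d y, u'⟩ = 0`.

Indeed a nonzero entry lives on a face of the cube spanned by an old chord `i` and the curl chord;
the curl edges are always merges or splits (`isMergeAt_curl_last_iff`, `isSplitAt_curl_last_iff`),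
and the `i`-edges are merges/splits exactly when they are in `G` (`isMergeAt_curl_castSucc_iff`),
in which case the face anticommutes (`sum_incidence_mul_incidence_face_local`), while otherwise
both paths vanish (`sum_incidence_mul_incidence_face_of_not`). This is the input making the chain
map of Khovanov (2000), §5.1–5.2 / Bar-Natan (2002), §4 commute with the differentials without
any planarity hypothesis. No named fact is introduced.

## References

* M. Khovanov, *A categorification of the Jones polynomial*, Duke Math. J. 101 (2000) 359–426,
  §4.2 (the complex of `D'` as a cone), §5.1–5.2, Prop. 8. [cite: Khovanov2000, §5.1]
* D. Bar-Natan, *On Khovanov's categorification of the Jones polynomial*, Algebr. Geom. Topol. 2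
  (2002) 337–370, §4. [cite: BarNatan2002, §4]
-/

open Function Finset

noncomputable section

namespace Literature.Topology.FourManifolds

namespace GaussDiagram

variable (G : GaussDiagram) (tf : Bool) (ε : ℤˣ) {R : Type} [CommRing R]

/-- The curl chord, `0`-smoothed, is a merge or a split (according to the sign of the curl), in
every state of the old chords. [folklore] -/
theorem isMergeAt_or_isSplitAt_curl_last (σ : G.State) :
    (G.curl tf ε).IsMergeAt (G.curlState tf ε σ false) (Fin.last G.n) ∨
      (G.curl tf ε).IsSplitAt (G.curlState tf ε σ false) (Fin.last G.n) := by
  rcases Int.units_eq_one_or ε with rfl | rfl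
  · exact Or.inl ((G.isMergeAt_curl_last_iff tf 1 σ false).2 ⟨rfl, rfl⟩)
  · exact Or.inr ((G.isSplitAt_curl_last_iff tf (-1) σ false).2 ⟨rfl, rfl⟩)

/-- A merge-or-split old chord stays merge-or-split in the curled diagram. [folklore] -/
theorem isMergeAt_or_isSplitAt_curl_castSucc {σ : G.State} {i : Fin G.n} (b : Bool)
    (hms : G.IsMergeAt σ i ∨ G.IsSplitAt σ i) :
    (G.curl tf ε).IsMergeAt (G.curlState tf ε σ b) i.castSucc ∨
      (G.curl tf ε).IsSplitAt (G.curlState tf ε σ b) i.castSucc := by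
  rcases hms with hm | hsp
  · exact Or.inl ((G.isMergeAt_curl_castSucc_iff tf ε σ b i).2 hm)
  · exact Or.inr ((G.isSplitAt_curl_castSucc_iff tf ε σ b i).2 hsp)

/-- A one-to-one bifurcation old chord stays a one-to-one bifurcation in the curled diagram.
[folklore] -/
theorem not_isMergeAt_and_not_isSplitAt_curl_castSucc {σ : G.State} {i : Fin G.n} (b : Bool)
    (hms : ¬ (G.IsMergeAt σ i ∨ G.IsSplitAt σ i)) :
    ¬ (G.curl tf ε).IsMergeAt (G.curlState tf ε σ b) i.castSucc ∧
      ¬ (G.curl tf ε).IsSplitAt (G.curlState tf ε σ b) i.castSucc :=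
  ⟨fun hm ↦ hms (Or.inl ((G.isMergeAt_curl_castSucc_iff tf ε σ b i).1 hm)),
    fun hsp ↦ hms (Or.inr ((G.isSplitAt_curl_castSucc_iff tf ε σ b i).1 hsp))⟩

/-- **The face of the curled diagram spanned by an old chord `i` and the curl chord
anticommutes**: for `s'` over `curlState σ false` and `u'` over `curlState σ[i ↦ 1] true`,
`∑_y ⟨d s', y⟩ ⟨d y, u'⟩ = 0` — by the local face theorem when the `i`-edges are merges or splits,
termwise otherwise. Khovanov (2000), Prop. 8 / §5.1–5.2. [cite: Khovanov2000, §5.1] -/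
theorem sum_incidence_mul_incidence_curl_face (h t : R) {σ : G.State} {i : Fin G.n}
    (hi : σ i = false) (s' u' : (G.curl tf ε).EnhancedState)
    (hs : s'.state = G.curlState tf ε σ false)
    (hu : u'.state = G.curlState tf ε (Function.update σ i true) true) :
    ∑ y, (G.curl tf ε).incidence R h t s' y * (G.curl tf ε).incidence R h t y u' = 0 := by
  have hij : i.castSucc ≠ Fin.last G.n := (Fin.castSucc_lt_last i).ne
  have hi' : (G.curlState tf ε σ false) i.castSucc = false := by
    rw [curlState_castSucc]; exact hi
  have hl' : (G.curlState tf ε σ false) (Fin.last G.n) = false := G.curlState_last tf ε σ false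
  have hu'' : u'.state = Function.update (Function.update (G.curlState tf ε σ false)
      i.castSucc true) (Fin.last G.n) true := by
    rw [hu, update_curlState_castSucc, update_curlState_last]
  by_cases hms : G.IsMergeAt σ i ∨ G.IsSplitAt σ i
  · obtain ⟨S, la, hla⟩ := s'
    obtain ⟨U, nu, hnu⟩ := u'
    simp only at hs hu''
    subst hs
    subst hu''
    refine sum_incidence_mul_incidence_face_local h t hij hi' hl' ?_ ?_ ?_ ?_
    · exact G.isMergeAt_or_isSplitAt_curl_castSucc tf ε false hms
    · rw [update_curlState_castSucc]
      exact G.isMergeAt_or_isSplitAt_curl_last tf ε _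
    · exact G.isMergeAt_or_isSplitAt_curl_last tf ε σ
    · rw [update_curlState_last]
      exact G.isMergeAt_or_isSplitAt_curl_castSucc tf ε true hms
  · have hs₁ : s'.state i.castSucc = false := by rw [hs]; exact hi'
    refine sum_incidence_mul_incidence_face_of_not h t hij hs₁ (by rw [hs]; exact hu'') ?_ ?_
    · rw [hs]
      exact G.not_isMergeAt_and_not_isSplitAt_curl_castSucc tf ε false hms
    · rw [hs, update_curlState_last]
      exact G.not_isMergeAt_and_not_isSplitAt_curl_castSucc tf ε true hms

/-- **The entries of `d'²` from the `0`-smoothed to the `1`-smoothed curl vanish, for every Gauss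
diagram**: if `s'` has the curl chord `0`-smoothed and `u'` has it `1`-smoothed, then
`∑_y ⟨d s', y⟩ ⟨d y, u'⟩ = 0`. Equivalently the curl edge `Φ` of `KhCurlIncidence` satisfies
`Φ d₀ + d₁ Φ = 0` (multiplication, resp. comultiplication, at the base point commutes with the
old differential up to the Koszul sign). A nonzero entry would live on a face spanned by an old
chord and the curl chord (`sum_incidence_mul_incidence_curl_face`). Khovanov (2000), §4.2
(`C(D')` is the cone of the curl edge), §5.1–5.2; Bar-Natan (2002), §4. [cite: Khovanov2000, §4.2] -/
theorem sum_incidence_mul_incidence_curl_eq_zero (h t : R) (s' u' : (G.curl tf ε).EnhancedState)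
    (hs : s'.state (Fin.last G.n) = false) (hu : u'.state (Fin.last G.n) = true) :
    ∑ y, (G.curl tf ε).incidence R h t s' y * (G.curl tf ε).incidence R h t y u' = 0 := by
  set σ : G.State := fun j ↦ s'.state j.castSucc with hσ
  have hS : s'.state = G.curlState tf ε σ false := by
    rw [← hs]; exact G.eq_curlState tf ε s'.state
  by_cases hface : ∃ i : Fin G.n, σ i = false ∧
      u'.state = G.curlState tf ε (Function.update σ i true) true
  · obtain ⟨i, hi, hu'⟩ := hface
    exact G.sum_incidence_mul_incidence_curl_face tf ε h t hi s' u' hS hu'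
  · -- no face: every term vanishes
    refine Finset.sum_eq_zero fun y _ ↦ ?_
    by_contra h0
    have h1 : (G.curl tf ε).incidence R h t s' y ≠ 0 := fun e ↦ h0 (by rw [e, zero_mul])
    have h2 : (G.curl tf ε).incidence R h t y u' ≠ 0 := fun e ↦ h0 (by rw [e, mul_zero])
    obtain ⟨k, hk, hyk⟩ := exists_of_incidence_ne_zero h1
    obtain ⟨l, hl, hul⟩ := exists_of_incidence_ne_zero h2
    apply hface
    rw [hS] at hyk
    rcases Fin.eq_castSucc_or_eq_last k with ⟨i, rfl⟩ | rfl
    · -- first `i`, then necessarily the curl chord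
      rw [update_curlState_castSucc] at hyk
      have hσi : σ i = false := hk
      rcases Fin.eq_castSucc_or_eq_last l with ⟨i', rfl⟩ | rfl
      · rw [hyk, update_curlState_castSucc] at hul
        have := congrFun hul (Fin.last G.n)
        rw [hu, curlState_last] at this
        exact Bool.noConfusion this
      · rw [hyk, update_curlState_last] at hul
        exact ⟨i, hσi, hul⟩
    · -- first the curl chord, then an old chord `i`
      rw [update_curlState_last] at hyk
      rcases Fin.eq_castSucc_or_eq_last l with ⟨i, rfl⟩ | rfl
      · rw [hyk, curlState_castSucc] at hl
        rw [hyk, update_curlState_castSucc] at hul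
        exact ⟨i, hl, hul⟩
      · rw [hyk, curlState_last] at hl
        exact Bool.noConfusion hl

end GaussDiagram

end Literature.Topology.FourManifolds
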